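import Summits.CriticalPhenomena.PercolationContinuityZ3.Theorems.SahiMasterFamilyUCBernsteinNested

/-!
# Conjecture (B) for every ROOTABLE pair of union-closed families, every order — the recursive root-choice form of the block-expansion
# method (99.5 % of all pairs on 4 points); the disjoint-union pairs of `…UCBernsteinNested` are rootable at every root

Unit `prim-masterthm-p4` (gen 22; crux anchor stmt-CriticalPhenomena-4575, helper work; memo
`run/shared/lean/prim/prim-masterthm/prim-masterthm-p4/P4-GEN22-REPORT.md` §2c).  Companion of `…BernsteinPos` (the identity
`Φ(β) = W(β) + Σ_{B∋last}(|B|−1)!(1−β_B)(−κ_B)` and the cap identity for every real `β`, `BPos`, `mix`, `comap`) and `…UCBernsteinNested` (conjecture (B)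
for pairs with the disjoint-union condition; the vanishing lemma); the `UCBernstein.layerSum` form of the theorem is in `…UCBernsteinRootableLayers`.

THE PREDICATE `Rootable n 𝒰 𝒱` (inductive; the exact hypothesis under which the block-expansion induction of this programme has NO negative term at any
level, memo §2c): a pair of families of subsets of `Fin (n+1)` is rootable if
* (`vanish`) `univ` lies in neither family and `univ` is not a disjoint union `A ⊔ B`, `A ∈ 𝒰`, `B ∈ 𝒱`; or
* (`both`) `univ ∈ 𝒰 ∩ 𝒱` and for SOME root `z`, for every block `B ∋ z`, `B ≠ univ`, not in `𝒰 ∩ 𝒱` (the blocks with a nonzero defect factor), the pair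
  restricted to `univ ∖ B` (pulled back along any enumeration of `univ ∖ B`) is rootable; or
* (`right`) `univ ∈ 𝒱 ∖ 𝒰` and for some root `z` lying in NO member of `𝒰`, for every block `B ∋ z`, `B ∉ 𝒱`, the restricted pair is rootable; or
* (`left`) the mirror image.

**THEOREM (every order)** `bpos_phiSet_mix_of_rootable`: if `𝒰, 𝒱` are union-closed and `Rootable n 𝒰 𝒱`, the edge polynomial
`w ↦ Φ_{n+1}(w·1_𝒰 + (1−w)·1_𝒱)` is `BPos (n+1)` — all its degree-`(n+1)` Bernstein coefficients (the layer sums of conjecture (B)) are `≥ 0`.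
`rootable_of_disjointUnion`: every union-closed pair with the disjoint-union condition (hence every nested pair, every pair of up-sets) is rootable.
REACH (memo §2c, exact enumeration, code-g22/exp17–18.py): rootable pairs are ALL 616 ordered orbit-pairs of distinct union-closed families `∋ univ` on 3
points and 372 780 of the 374 550 on 4 points (99.53 %; disjoint-union pairs: 75.4 %); ≈ 97 % of random pairs on 5 points.  The non-rootable residue consists
of the crossing / bi-glued designs (e.g. `𝒰 = {a,b,ab,abcd}`, `𝒱 = {c,d,cd,abcd}`: whatever the root, some complementary block splits as `A ⊔ B`, `A ∈ 𝒰∖𝒱`,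
`B ∈ 𝒱∖𝒰`) — exactly where the cap term `W` must absorb a negative product of ray polynomials (memo §1), the open core of (B) for two families.
PROOF: induction on the derivation of `Rootable`; at a `both`/`right` node relabel the root to the last index (`PhiCert.phiSet_actV`) and apply the identity of
`…BernsteinPos`; every block term is either killed by its defect factor or handled by the induction hypothesis for the pulled-back pair (whose ground set is
enumerated by the complementary embedding of `UCBernsteinNested.exists_emb_coRest'` composed with the relabelling); a `vanish` node is
`phiSet_mix_eq_zero_of_noDecomp` (the hypothesis "no complementary decomposition" propagates down the block expansion); `left` is `right` for the mirror pair.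
HONEST FRAMING: structural, every order; the non-rootable pairs, conjecture (B) in general, `UCHullNonneg k` (k ≥ 8), Sahi's `C_k` and the master theorem
remain OPEN.  Axioms standard. [this work]
-/

noncomputable section

open scoped Classical

namespace Summit.CriticalPhenomena.PercolationContinuityZ3.Theorems

namespace UCBernsteinRootable

open Finset Function Equiv
open Literature.Combinatorics.Sahi2008
open Literature.Combinatorics.Sahi2008.CycleForm
open PrincipalCapBeta (phiSet realF realW)
open BernsteinPos UCBernsteinNested

/-! ### The predicate -/

/-- **Rootable pairs** (recursive root-choice criterion; module docstring). [this work] -/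
inductive Rootable : (n : ℕ) → Finset (Finset (Fin (n + 1))) → Finset (Finset (Fin (n + 1))) → Prop
  | vanish {n : ℕ} {𝒰 𝒱 : Finset (Finset (Fin (n + 1)))} (hU : univ ∉ 𝒰) (hV : univ ∉ 𝒱)
      (hno : ∀ A ∈ 𝒰, ∀ B ∈ 𝒱, Disjoint A B → A ∪ B ≠ univ) : Rootable n 𝒰 𝒱
  | both {n : ℕ} {𝒰 𝒱 : Finset (Finset (Fin (n + 1)))} (z : Fin (n + 1)) (hU : univ ∈ 𝒰) (hV : univ ∈ 𝒱)
      (h : ∀ B : Finset (Fin (n + 1)), z ∈ B → B ≠ univ → ¬(B ∈ 𝒰 ∧ B ∈ 𝒱) →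
        ∀ (m : ℕ) (e : Fin (m + 1) ↪ Fin (n + 1)), (univ : Finset (Fin (m + 1))).map e = univ \ B →
          Rootable m (comap e 𝒰) (comap e 𝒱)) : Rootable n 𝒰 𝒱
  | right {n : ℕ} {𝒰 𝒱 : Finset (Finset (Fin (n + 1)))} (z : Fin (n + 1)) (hU : univ ∉ 𝒰) (hV : univ ∈ 𝒱)
      (hz : ∀ S ∈ 𝒰, z ∉ S)
      (h : ∀ B : Finset (Fin (n + 1)), z ∈ B → B ∉ 𝒱 →
        ∀ (m : ℕ) (e : Fin (m + 1) ↪ Fin (n + 1)), (univ : Finset (Fin (m + 1))).map e = univ \ B →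
          Rootable m (comap e 𝒰) (comap e 𝒱)) : Rootable n 𝒰 𝒱
  | left {n : ℕ} {𝒰 𝒱 : Finset (Finset (Fin (n + 1)))} (z : Fin (n + 1)) (hU : univ ∈ 𝒰) (hV : univ ∉ 𝒱)
      (hz : ∀ S ∈ 𝒱, z ∉ S)
      (h : ∀ B : Finset (Fin (n + 1)), z ∈ B → B ∉ 𝒰 →
        ∀ (m : ℕ) (e : Fin (m + 1) ↪ Fin (n + 1)), (univ : Finset (Fin (m + 1))).map e = univ \ B →
          Rootable m (comap e 𝒰) (comap e 𝒱)) : Rootable n 𝒰 𝒱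

variable {n : ℕ}

/-! ### Plumbing: iterated pull-backs and ranges -/

/-- Pull-backs compose. [this work] -/
theorem comap_comap {m l : ℕ} (e : Fin l ↪ Fin m) (f : Fin m ↪ Fin n) (𝒰 : Finset (Finset (Fin n))) :
    comap e (comap f 𝒰) = comap (e.trans f) 𝒰 := by
  ext S
  rw [mem_comap, mem_comap, mem_comap, Finset.map_map]

/-- Range of an embedding composed with a permutation. [this work] -/
theorem map_univ_trans_perm {m : ℕ} (e : Fin (m + 1) ↪ Fin (n + 1)) (σ : Perm (Fin (n + 1))) (B : Finset (Fin (n + 1)))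
    (he : (univ : Finset (Fin (m + 1))).map e = univ \ B) :
    (univ : Finset (Fin (m + 1))).map (e.trans σ.toEmbedding) = univ \ B.map σ.toEmbedding := by
  rw [← Finset.map_map, he, Finset.map_sdiff, Finset.map_univ_equiv]

/-! ### The vanishing lemma under "no complementary decomposition" -/

/-- If `univ` lies in neither union-closed family and is not a disjoint union `A ⊔ B` (`A ∈ 𝒰`, `B ∈ 𝒱`), the edge polynomial vanishes identically
(the hypothesis propagates to the complement of every block of nonzero weight). [this work] -/
theorem phiSet_mix_eq_zero_of_noDecomp : ∀ (n : ℕ) (𝒰 𝒱 : Finset (Finset (Fin (n + 1)))),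
    (∀ A ∈ 𝒰, ∀ B ∈ 𝒰, A ∪ B ∈ 𝒰) → (∀ A ∈ 𝒱, ∀ B ∈ 𝒱, A ∪ B ∈ 𝒱) → univ ∉ 𝒰 → univ ∉ 𝒱 →
    (∀ A ∈ 𝒰, ∀ B ∈ 𝒱, Disjoint A B → A ∪ B ≠ univ) → ∀ w : ℝ, phiSet (n + 1) (mix 𝒰 𝒱 w) = 0 := by
  intro n
  induction n using Nat.strong_induction_on with
  | _ n ih =>
  intro 𝒰 𝒱 hU hV htopU htopV hno w
  rw [phiSet_eq_sum_blocks_last]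
  refine sum_eq_zero fun B hB => ?_
  have hlB : Fin.last n ∈ B := (mem_filter.1 hB).2
  by_cases hBUV : B ∈ 𝒰 ∨ B ∈ 𝒱
  · have hBu : B ≠ univ := by rintro rfl; exact hBUV.elim htopU htopV
    obtain ⟨m, e, he, hsurj, hc⟩ := exists_emb_coRest' hBu
    have hm : m < n := PhiVertex.lt_of_emb_ne_last e fun j hj => he j (by rw [hj]; exact hlB)
    have hrange := map_univ_eq_sdiff e he hsurj
    -- the complement of `B` lies in neither family
    have hCU : univ \ B ∉ 𝒰 := by
      intro h
      rcases hBUV with hBU | hBV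
      · exact htopU (by have := hU _ hBU _ h; rwa [union_sdiff_of_subset (subset_univ B)] at this)
      · by_cases hBU : B ∈ 𝒰
        · exact htopU (by have := hU _ hBU _ h; rwa [union_sdiff_of_subset (subset_univ B)] at this)
        · exact hno _ h _ hBV sdiff_disjoint (sdiff_union_of_subset (subset_univ B))
    have hCV : univ \ B ∉ 𝒱 := by
      intro h
      rcases hBUV with hBU | hBV
      · by_cases hBV : B ∈ 𝒱
        · exact htopV (by have := hV _ hBV _ h; rwa [union_sdiff_of_subset (subset_univ B)] at this)
        · exact hno _ hBU _ h disjoint_sdiff (union_sdiff_of_subset (subset_univ B))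
      · exact htopV (by have := hV _ hBV _ h; rwa [union_sdiff_of_subset (subset_univ B)] at this)
    have htopU' : univ ∉ comap e 𝒰 := by rw [mem_comap, hrange]; exact hCU
    have htopV' : univ ∉ comap e 𝒱 := by rw [mem_comap, hrange]; exact hCV
    -- no complementary decomposition of the complement either
    have hno' : ∀ A ∈ comap e 𝒰, ∀ A' ∈ comap e 𝒱, Disjoint A A' → A ∪ A' ≠ univ := by
      intro A hA A' hA' hAA' hu
      have hAe : A.map e ∈ 𝒰 := (mem_comap e 𝒰 A).1 hA
      have hA'e : A'.map e ∈ 𝒱 := (mem_comap e 𝒱 A').1 hA'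
      have hdis : Disjoint (A.map e) (A'.map e) := (disjoint_map e).2 hAA'
      have hun : A.map e ∪ A'.map e = univ \ B := by rw [← Finset.map_union, hu, hrange]
      have hAB : Disjoint (A.map e) B :=
        Finset.disjoint_left.2 fun x hx hxB => by
          have : x ∈ univ \ B := hun ▸ mem_union_left _ hx
          exact (mem_sdiff.1 this).2 hxB
      have hA'B : Disjoint (A'.map e) B :=
        Finset.disjoint_left.2 fun x hx hxB => by
          have : x ∈ univ \ B := hun ▸ mem_union_right _ hx
          exact (mem_sdiff.1 this).2 hxB
      rcases hBUV with hBU | hBV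
      · -- absorb `B` into the `𝒰`-part
        refine hno _ (hU _ hAe _ hBU) _ hA'e (disjoint_union_left.2 ⟨hdis, hA'B.symm⟩) ?_
        rw [union_right_comm, hun, sdiff_union_of_subset (subset_univ B)]
      · refine hno _ hAe _ (hV _ hA'e _ hBV) (disjoint_union_right.2 ⟨hdis, hAB⟩) ?_
        rw [← union_assoc, hun, sdiff_union_of_subset (subset_univ B)]
    have hz := ih m hm (comap e 𝒰) (comap e 𝒱) (comap_unionClosed e 𝒰 hU) (comap_unionClosed e 𝒱 hV) htopU' htopV' hno' w
    rw [hc, mix_map, hz, neg_zero, mul_zero, mul_zero]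
  · have h0 : mix 𝒰 𝒱 w B = 0 := by
      unfold mix
      rw [if_neg (fun h => hBUV (Or.inl h)), if_neg (fun h => hBUV (Or.inr h))]; ring
    rw [h0, zero_mul, mul_zero]

/-! ### The two rooted steps, with the restricted functionals as hypotheses -/

/-- **Step `both`.**  `univ ∈ 𝒰 ∩ 𝒱`; a root `z`; the restricted edge polynomials along the blocks `B ∋ z` outside `𝒰 ∩ 𝒱` are Bernstein-positive
one order down ⇒ the edge polynomial is `BPos (n+1)`. [this work] -/
theorem bpos_step_both (𝒰 𝒱 : Finset (Finset (Fin (n + 1)))) (z : Fin (n + 1)) (hU : univ ∈ 𝒰) (hV : univ ∈ 𝒱)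
    (hrestr : ∀ B : Finset (Fin (n + 1)), z ∈ B → B ≠ univ → ¬(B ∈ 𝒰 ∧ B ∈ 𝒱) →
      ∀ (m : ℕ) (e : Fin (m + 1) ↪ Fin (n + 1)), (univ : Finset (Fin (m + 1))).map e = univ \ B →
        BPos (m + 1) (fun w => phiSet (m + 1) (mix (comap e 𝒰) (comap e 𝒱) w))) :
    BPos (n + 1) (fun w => phiSet (n + 1) (mix 𝒰 𝒱 w)) := by
  let σ : Perm (Fin (n + 1)) := Equiv.swap z (Fin.last n)
  set 𝒰' := comap σ.toEmbedding 𝒰 with hU'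
  set 𝒱' := comap σ.toEmbedding 𝒱 with hV'
  have hσ : σ (Fin.last n) = z := Equiv.swap_apply_right _ _
  have htopU' : univ ∈ 𝒰' := by rw [hU', mem_comap, Finset.map_univ_equiv]; exact hU
  have htopV' : univ ∈ 𝒱' := by rw [hV', mem_comap, Finset.map_univ_equiv]; exact hV
  -- block terms of the relabelled pair
  have hsub : ∀ B' : Finset (Fin (n + 1)), Fin.last n ∈ B' → B' ≠ univ → ¬(B' ∈ 𝒰' ∧ B' ∈ 𝒱') →
      BPos n (fun w => -coRest (realW (mix 𝒰' 𝒱' w)) realF B') := by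
    intro B' hB' hBu' hW'
    obtain ⟨m, e, he, hsurj, hc⟩ := exists_emb_coRest' hBu'
    have hm : m < n := PhiVertex.lt_of_emb_ne_last e fun j hj => he j (by rw [hj]; exact hB')
    have hrange := map_univ_eq_sdiff e he hsurj
    have hzB : z ∈ B'.map σ.toEmbedding := mem_map.2 ⟨Fin.last n, hB', hσ⟩
    have hBu : B'.map σ.toEmbedding ≠ univ := by
      intro h
      apply hBu'
      have := congrArg Finset.card h
      rw [card_map, card_univ] at this
      exact eq_univ_of_card _ this
    have hW : ¬(B'.map σ.toEmbedding ∈ 𝒰 ∧ B'.map σ.toEmbedding ∈ 𝒱) := by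
      rintro ⟨h1, h2⟩; exact hW' ⟨(mem_comap _ 𝒰 B').2 h1, (mem_comap _ 𝒱 B').2 h2⟩
    have key := hrestr (B'.map σ.toEmbedding) hzB hBu hW m (e.trans σ.toEmbedding) (map_univ_trans_perm e σ B' hrange)
    refine (key.mono (by omega)).congr fun w => ?_
    rw [hc, mix_map, hU', hV', comap_comap, comap_comap, neg_neg]
  have hW := (bpos_W' (k := n) 𝒰' 𝒱').mono (Nat.le_succ n)
  have hterms : BPos (n + 1) (fun w => ∑ B ∈ univ.filter (fun B : Finset (Fin (n + 1)) => Fin.last n ∈ B),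
      ((B.card - 1).factorial : ℝ) * ((1 - mix 𝒰' 𝒱' w B) * (-coRest (realW (mix 𝒰' 𝒱' w)) realF B))) := by
    refine BPos.sum _ (fun B w => ((B.card - 1).factorial : ℝ) *
      ((1 - mix 𝒰' 𝒱' w B) * (-coRest (realW (mix 𝒰' 𝒱' w)) realF B))) fun B hB => ?_
    have hlB : Fin.last n ∈ B := (mem_filter.1 hB).2
    by_cases hW' : B ∈ 𝒰' ∧ B ∈ 𝒱'
    · refine bpos_zero.congr fun w => ?_
      have h1 : mix 𝒰' 𝒱' w B = 1 := by
        unfold mix; rw [if_pos hW'.1, if_pos hW'.2]; ring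
      simp only [h1, sub_self, zero_mul, mul_zero]
    · have hBu : B ≠ univ := by rintro rfl; exact hW' ⟨htopU', htopV'⟩
      exact (((bpos_one_sub_mix' 𝒰' 𝒱' B).mul (hsub B hlB hBu hW')).smul (Nat.cast_nonneg _)).mono (by omega)
  have h := (hW.add hterms).congr fun w => (phiSet_eq_W_add_sum (mix 𝒰' 𝒱' w)).symm
  exact h.congr fun w => phiSet_mix_comap_perm σ 𝒰 𝒱 w

/-- **Step `right`.**  `univ ∈ 𝒱 ∖ 𝒰`; a root `z` in no member of `𝒰`; the restricted edge polynomials along the blocks `B ∋ z`, `B ∉ 𝒱`, are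
Bernstein-positive one order down ⇒ the edge polynomial is `BPos (n+1)`. [this work] -/
theorem bpos_step_right (𝒰 𝒱 : Finset (Finset (Fin (n + 1)))) (z : Fin (n + 1)) (hV : univ ∈ 𝒱) (hz : ∀ S ∈ 𝒰, z ∉ S)
    (hrestr : ∀ B : Finset (Fin (n + 1)), z ∈ B → B ∉ 𝒱 →
      ∀ (m : ℕ) (e : Fin (m + 1) ↪ Fin (n + 1)), (univ : Finset (Fin (m + 1))).map e = univ \ B →
        BPos (m + 1) (fun w => phiSet (m + 1) (mix (comap e 𝒰) (comap e 𝒱) w))) :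
    BPos (n + 1) (fun w => phiSet (n + 1) (mix 𝒰 𝒱 w)) := by
  let σ : Perm (Fin (n + 1)) := Equiv.swap z (Fin.last n)
  set 𝒰' := comap σ.toEmbedding 𝒰 with hU'
  set 𝒱' := comap σ.toEmbedding 𝒱 with hV'
  have hσ : σ (Fin.last n) = z := Equiv.swap_apply_right _ _
  have htopV' : univ ∈ 𝒱' := by rw [hV', mem_comap, Finset.map_univ_equiv]; exact hV
  have havoid : ∀ S ∈ 𝒰', Fin.last n ∉ S := by
    rw [hU']; exact last_notMem_of_comap_swap z 𝒰 hz
  have hsub : ∀ B' : Finset (Fin (n + 1)), Fin.last n ∈ B' → B' ∉ 𝒱' →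
      BPos n (fun w => -coRest (realW (mix 𝒰' 𝒱' w)) realF B') := by
    intro B' hB' hBV'
    have hBu' : B' ≠ univ := by rintro rfl; exact hBV' htopV'
    obtain ⟨m, e, he, hsurj, hc⟩ := exists_emb_coRest' hBu'
    have hm : m < n := PhiVertex.lt_of_emb_ne_last e fun j hj => he j (by rw [hj]; exact hB')
    have hrange := map_univ_eq_sdiff e he hsurj
    have hzB : z ∈ B'.map σ.toEmbedding := mem_map.2 ⟨Fin.last n, hB', hσ⟩
    have hBV : B'.map σ.toEmbedding ∉ 𝒱 := fun h => hBV' ((mem_comap _ 𝒱 B').2 h)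
    have key := hrestr (B'.map σ.toEmbedding) hzB hBV m (e.trans σ.toEmbedding) (map_univ_trans_perm e σ B' hrange)
    refine (key.mono (by omega)).congr fun w => ?_
    rw [hc, mix_map, hU', hV', comap_comap, comap_comap, neg_neg]
  have hW := bpos_W' (k := n) 𝒰' 𝒱'
  have hterms : BPos n (fun w => ∑ B ∈ univ.filter (fun B : Finset (Fin (n + 1)) => Fin.last n ∈ B),
      ((B.card - 1).factorial : ℝ) * ((1 - (if B ∈ 𝒱' then (1 : ℝ) else 0)) *
        (-coRest (realW (mix 𝒰' 𝒱' w)) realF B))) := by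
    refine BPos.sum _ (fun B w => ((B.card - 1).factorial : ℝ) * ((1 - (if B ∈ 𝒱' then (1 : ℝ) else 0)) *
        (-coRest (realW (mix 𝒰' 𝒱' w)) realF B))) fun B hB => ?_
    have hlB : Fin.last n ∈ B := (mem_filter.1 hB).2
    by_cases hBV : B ∈ 𝒱'
    · exact bpos_zero.congr fun w => by rw [if_pos hBV]; ring
    · exact ((hsub B hlB hBV).smul (Nat.cast_nonneg _)).congr fun w => by rw [if_neg hBV]; ring
  have h : BPos (n + 1) (fun w => phiSet (n + 1) (mix 𝒰' 𝒱' w)) := by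
    refine ((bpos_one_sub.mul (hW.add hterms)).mono (by omega)).congr fun w => ?_
    rw [phiSet_eq_sum_blocks_last, ← sum_blocks_coRest_eq_W (mix 𝒰' 𝒱' w), ← sum_add_distrib, mul_sum]
    refine sum_congr rfl fun B hB => ?_
    have hlB : Fin.last n ∈ B := (mem_filter.1 hB).2
    have hBU : B ∉ 𝒰' := fun h => havoid B h hlB
    have e1 : mix 𝒰' 𝒱' w B = (1 - w) * (if B ∈ 𝒱' then (1 : ℝ) else 0) := by
      unfold mix; rw [if_neg hBU]; ring
    rw [e1]
    ring
  exact h.congr fun w => phiSet_mix_comap_perm σ 𝒰 𝒱 w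

/-! ### The theorem -/

/-- **THEOREM ((B) for rootable pairs, every order).**  A rootable pair of union-closed families has a Bernstein-positive edge polynomial:
all degree-`(n+1)` Bernstein coefficients of `w ↦ Φ_{n+1}(w·1_𝒰 + (1−w)·1_𝒱)` — the layer sums of conjecture (B) — are nonnegative. [this work] -/
theorem bpos_phiSet_mix_of_rootable {n : ℕ} {𝒰 𝒱 : Finset (Finset (Fin (n + 1)))} (hr : Rootable n 𝒰 𝒱) :
    (∀ A ∈ 𝒰, ∀ B ∈ 𝒰, A ∪ B ∈ 𝒰) → (∀ A ∈ 𝒱, ∀ B ∈ 𝒱, A ∪ B ∈ 𝒱) →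
      BPos (n + 1) (fun w => phiSet (n + 1) (mix 𝒰 𝒱 w)) := by
  induction hr with
  | vanish hU hV hno =>
    intro hUC hVC
    exact bpos_zero.congr fun w => (phiSet_mix_eq_zero_of_noDecomp _ _ _ hUC hVC hU hV hno w).symm
  | both z hU hV h ih =>
    intro hUC hVC
    exact bpos_step_both _ _ z hU hV fun B hzB hBu hW m e he =>
      ih B hzB hBu hW m e he (comap_unionClosed e _ hUC) (comap_unionClosed e _ hVC)
  | right z hU hV hz h ih =>
    intro hUC hVC
    exact bpos_step_right _ _ z hV hz fun B hzB hBV m e he =>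
      ih B hzB hBV m e he (comap_unionClosed e _ hUC) (comap_unionClosed e _ hVC)
  | left z hU hV hz h ih =>
    intro hUC hVC
    -- the mirror pair is a `right` configuration
    have hmirror := bpos_step_right _ _ z hU hz fun B hzB hBU m e he =>
      ((ih B hzB hBU m e he (comap_unionClosed e _ hUC) (comap_unionClosed e _ hVC)).reflect).congr
        fun w => by rw [mix_swap]
    exact hmirror.reflect.congr fun w => by rw [mix_swap]

/-- Pointwise: `(UC-hull)` on every rootable edge, every order. [this work] -/
theorem phiSet_mix_nonneg_of_rootable {𝒰 𝒱 : Finset (Finset (Fin (n + 1)))} (hr : Rootable n 𝒰 𝒱)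
    (hU : ∀ A ∈ 𝒰, ∀ B ∈ 𝒰, A ∪ B ∈ 𝒰) (hV : ∀ A ∈ 𝒱, ∀ B ∈ 𝒱, A ∪ B ∈ 𝒱) {w : ℝ} (hw0 : 0 ≤ w) (hw1 : w ≤ 1) :
    0 ≤ phiSet (n + 1) (mix 𝒰 𝒱 w) :=
  (bpos_phiSet_mix_of_rootable hr hU hV).nonneg hw0 hw1

/-! ### Disjoint-union pairs are rootable -/

/-- **Every union-closed pair with the disjoint-union condition is rootable** (at any root; by strong induction on the order). [this work] -/
theorem rootable_of_disjointUnion : ∀ (n : ℕ) (𝒰 𝒱 : Finset (Finset (Fin (n + 1)))),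
    (∀ A ∈ 𝒰, ∀ B ∈ 𝒰, A ∪ B ∈ 𝒰) → (∀ A ∈ 𝒱, ∀ B ∈ 𝒱, A ∪ B ∈ 𝒱) →
    (∀ A ∈ 𝒰, ∀ B ∈ 𝒱, Disjoint A B → A ∪ B ∈ 𝒰 ∪ 𝒱) → Rootable n 𝒰 𝒱 := by
  intro n
  induction n using Nat.strong_induction_on with
  | _ n ih =>
  intro 𝒰 𝒱 hU hV hD
  have hrec : ∀ (x : Fin (n + 1)) (B : Finset (Fin (n + 1))), x ∈ B → ∀ (m : ℕ) (e : Fin (m + 1) ↪ Fin (n + 1)),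
      (univ : Finset (Fin (m + 1))).map e = univ \ B → Rootable m (comap e 𝒰) (comap e 𝒱) := by
    intro x B hxB m e he
    have hm : m < n := by
      have hcard : (univ \ B).card = m + 1 := by rw [← he, card_map, card_univ, Fintype.card_fin]
      have hlt : (univ \ B).card < (univ : Finset (Fin (n + 1))).card :=
        card_lt_card ⟨sdiff_subset, fun hsub => (mem_sdiff.1 (hsub (mem_univ x))).2 hxB⟩
      rw [hcard, card_univ, Fintype.card_fin] at hlt
      omega
    exact ih m hm _ _ (comap_unionClosed e 𝒰 hU) (comap_unionClosed e 𝒱 hV) (comap_disjointUnion e 𝒰 𝒱 hD)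
  by_cases htopU : univ ∈ 𝒰 <;> by_cases htopV : univ ∈ 𝒱
  · exact Rootable.both (Fin.last n) htopU htopV fun B hzB _ _ m e he => hrec _ B hzB m e he
  · obtain ⟨t, ht⟩ := PhiSegment.exists_forall_notMem 𝒱 hV htopV
    exact Rootable.left t htopU htopV ht fun B hzB _ m e he => hrec _ B hzB m e he
  · obtain ⟨t, ht⟩ := PhiSegment.exists_forall_notMem 𝒰 hU htopU
    exact Rootable.right t htopU htopV ht fun B hzB _ m e he => hrec _ B hzB m e he
  · exact Rootable.vanish htopU htopV fun A hA B hB hAB hu =>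
      (mem_union.1 (hD A hA B hB hAB)).elim (fun h => htopU (hu ▸ h)) (fun h => htopV (hu ▸ h))

end UCBernsteinRootable

end Summit.CriticalPhenomena.PercolationContinuityZ3.Theorems
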